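import Literature.AnabelianGeometry.SemiGraphs.TemperedPiVerticialLevelData
import Literature.AnabelianGeometry.SemiGraphs.TemperedVerticialNamedFactsProofs

/-!
# `Π_v` acts faithfully on the vertex fibres of the Galois tower ([SemiAnbd] Thm 3.7 (i), p. 40)

Mochizuki, *Semi-graphs of anabelioids*, §3, Thm. 3.7 (i), author's manuscript p. 40
[cite: MochizukiSemiAnbd2006, Thm 3.7(i) p.40]: "there is a natural continuous, injective outer
homomorphism `π̂₁(𝒢_v) ↪ π₁^temp(𝒢)`".

For Galois level data `D` (seat abc-iut-L3-t9's tower `S n`, `𝒢_{∞,S n} = D.cover n`) and a compatible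
point sequence `T` over `v` (seat abc-iut-L3-t6's `PointSeq`, decomposition homomorphism
`T.decompHom : Π_v → π₁^temp`), an element of `Π_v` fixing the points `T.pt n` of all the `𝒢_{∞,S n}`
is killed by `T.decompHom` (`PointSeq.decompHom_eq_one_of_forall_fixes`); the action of `Π_v` on
`𝒢_{∞,S n}` is through the points of `S n` (`cover_ρ_eq_self_of_proj`).  For the tower of Prop. 3.6
(`𝒢.galoisLevelData h36`) under the hypotheses of Thm. 3.7, every verticial homomorphism is injective
(`verticialInjective_holds`, seat abc-iut-L3-t8) and is such a decomposition homomorphism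
(`exists_pointSeq_of_isVerticialHom`, abc-iut-L3-t8), whence the input **(I0v)** of the (β) contract
(abc-iut-L3-t11's `hfaithV`): **an element of `Π_v` acting trivially on the `v`-fibres of all the finite
levels `S n` is trivial** (`galoisLevelData_faithfulV`).  Proof-only (seat abc-iut-L3-t6); nothing here
bears on [IUTchIII] Cor. 3.12.
-/

namespace Literature.AnabelianGeometry.SemiGraphs

namespace ProfiniteSemiGraph

open CategoryTheory Topology

universe u

variable {𝒢 : ProfiniteSemiGraph.{u}}

namespace GaloisLevelData

variable (D : GaloisLevelData 𝒢) (h𝒢 : 𝒢.IsCountable)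

/-- The action of `Π_v` on a point of `𝒢_{∞,S n}` is through its image in `S n`: if `h` fixes the image
point of `S n`, it fixes the point of `𝒢_{∞,S n}` (orbit and path class are untouched).
[cite: MochizukiSemiAnbd2006, Prop 3.6 p.38] -/
theorem cover_ρ_eq_self_of_proj (n : ℕ) {v : 𝒢.graph.Vertex} (h : 𝒢.Gv v)
    (t : ((D.cover h𝒢 n).SV v).obj.V)
    (ht : ((D.S n).SV v).obj.ρ h ((((D.S n).univCoverOverProj (Sum.inl (D.W n)) h𝒢).fV v).hom.hom t) =
      (((D.S n).univCoverOverProj (Sum.inl (D.W n)) h𝒢).fV v).hom.hom t) :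
    ((D.cover h𝒢 n).SV v).obj.ρ h t = t :=
  CovObj.FibV.ext (D.S n) (Sum.inl (D.W n)) rfl ht HEq.rfl

/-- In particular an element of `Π_v` fixing every point of `(S n)_v` fixes every point of
`(𝒢_{∞,S n})_v`. [cite: MochizukiSemiAnbd2006, Prop 3.6 p.38] -/
theorem cover_ρ_eq_self_of_forall (n : ℕ) {v : 𝒢.graph.Vertex} (h : 𝒢.Gv v)
    (hfix : ∀ x : ((D.S n).SV v).obj.V, ((D.S n).SV v).obj.ρ h x = x)
    (t : ((D.cover h𝒢 n).SV v).obj.V) : ((D.cover h𝒢 n).SV v).obj.ρ h t = t :=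
  D.cover_ρ_eq_self_of_proj h𝒢 n h t (hfix _)

namespace PointSeq

variable {D h𝒢} {v : 𝒢.graph.Vertex} (T : D.PointSeq h𝒢 v)

/-- **An element of `Π_v` fixing all the points `T.pt n` is killed by the decomposition homomorphism**
(the kernel of the `n`-th component is the stabiliser of `T.pt n`, `gal_eq_one_iff`).
[cite: MochizukiSemiAnbd2006, Thm 3.7(i) p.40] -/
theorem decompHom_eq_one_of_forall_fixes (h : 𝒢.Gv v)
    (hfix : ∀ n, ((D.cover h𝒢 n).SV v).obj.ρ h (T.pt n) = T.pt n) : T.decompHom h = 1 :=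
  D.pi_ext h𝒢 fun n => by
    rw [proj_decompHom, map_one]
    exact (T.gal_eq_one_iff n h).mpr (hfix n)

/-- The kernel of the decomposition homomorphism is the joint stabiliser of the points `T.pt n`.
[cite: MochizukiSemiAnbd2006, Thm 3.7(i) p.40] -/
theorem decompHom_eq_one_iff (h : 𝒢.Gv v) :
    T.decompHom h = 1 ↔ ∀ n, ((D.cover h𝒢 n).SV v).obj.ρ h (T.pt n) = T.pt n := by
  refine ⟨fun h1 n => (T.gal_eq_one_iff n h).mp ?_, T.decompHom_eq_one_of_forall_fixes h⟩
  rw [← proj_decompHom, h1, map_one]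

/-- **With an injective decomposition homomorphism, an element of `Π_v` fixing all `T.pt n` is
trivial.** [cite: MochizukiSemiAnbd2006, Thm 3.7(i) p.40] -/
theorem eq_one_of_forall_fixes (hinj : Function.Injective T.decompHom) (h : 𝒢.Gv v)
    (hfix : ∀ n, ((D.cover h𝒢 n).SV v).obj.ρ h (T.pt n) = T.pt n) : h = 1 :=
  hinj (by rw [T.decompHom_eq_one_of_forall_fixes h hfix, map_one])

/-- The same with the hypothesis at the finite levels: an element of `Π_v` fixing the images of the
`T.pt n` in the `S n` is trivial. [cite: MochizukiSemiAnbd2006, Thm 3.7(i) p.40] -/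
theorem eq_one_of_forall_fixes_proj (hinj : Function.Injective T.decompHom) (h : 𝒢.Gv v)
    (hfix : ∀ n, ((D.S n).SV v).obj.ρ h
      ((((D.S n).univCoverOverProj (Sum.inl (D.W n)) h𝒢).fV v).hom.hom (T.pt n)) =
      (((D.S n).univCoverOverProj (Sum.inl (D.W n)) h𝒢).fV v).hom.hom (T.pt n)) : h = 1 :=
  T.eq_one_of_forall_fixes hinj h fun n => D.cover_ρ_eq_self_of_proj h𝒢 n h (T.pt n) (hfix n)

end PointSeq

end GaloisLevelData

/-! ### (I0v) for the tower of Proposition 3.6 -/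

variable (𝒢) in
/-- **(I0v) `Π_v` acts faithfully on the vertex fibres of the Galois tower**: under the hypotheses of
Thm. 3.7, an element `h ∈ Π_v` acting trivially on `(S n)_v` for every level `S n` of the tower
`𝒢.galoisLevelData` is trivial — a verticial homomorphism at `v` exists and is injective (Thm. 3.7 (i),
`verticialInjective_holds`), it is the decomposition homomorphism of a compatible point sequence
(`exists_pointSeq_of_isVerticialHom`), and `h` lies in its kernel. (The (β)-contract input `hfaithV` of
seat abc-iut-L3-t11.) [cite: MochizukiSemiAnbd2006, Thm 3.7(i) p.40] -/
theorem galoisLevelData_faithfulV (h37 : 𝒢.Thm37Hypotheses) (v : 𝒢.graph.Vertex) (h : 𝒢.Gv v)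
    (hfix : ∀ (n : ℕ) (x : (((𝒢.galoisLevelData h37.toProp36Hypotheses).S n).SV v).obj.V),
      (((𝒢.galoisLevelData h37.toProp36Hypotheses).S n).SV v).obj.ρ h x = x) : h = 1 := by
  obtain ⟨hne, hinj⟩ := verticialInjective_holds 𝒢 h37 (𝒢.temperedPiChart h37.toProp36Hypotheses) v
  obtain ⟨H, ψ, hψ, -⟩ := hne
  obtain ⟨P, hP⟩ := exists_pointSeq_of_isVerticialHom (h36 := h37.toProp36Hypotheses) (ψ := ψ) hψ
  have hinjP : Function.Injective P.decompHom := by rw [hP]; exact hinj ψ hψ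
  exact P.eq_one_of_forall_fixes hinjP h fun n =>
    (𝒢.galoisLevelData h37.toProp36Hypotheses).cover_ρ_eq_self_of_forall h37.toProp36Hypotheses.isCountable
      n h (hfix n) (P.pt n)

variable (𝒢) in
/-- **(I0v), kernel form**: the joint kernel of the actions of `Π_v` on the `v`-fibres of the levels of
the tower is trivial. [cite: MochizukiSemiAnbd2006, Thm 3.7(i) p.40] -/
theorem galoisLevelData_iInf_ker_ρ_eq_bot (h37 : 𝒢.Thm37Hypotheses) (v : 𝒢.graph.Vertex) :
    ⨅ n, ((((𝒢.galoisLevelData h37.toProp36Hypotheses).S n).SV v).obj.ρ).ker = (⊥ : Subgroup (𝒢.Gv v)) := by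
  rw [eq_bot_iff]
  intro h hh
  rw [Subgroup.mem_bot]
  refine galoisLevelData_faithfulV 𝒢 h37 v h fun n x => ?_
  have hn := (Subgroup.mem_iInf.mp hh) n
  rw [MonoidHom.mem_ker] at hn
  change ((((𝒢.galoisLevelData h37.toProp36Hypotheses).S n).SV v).obj.ρ h) x = x
  rw [hn]
  rfl

end ProfiniteSemiGraph

end Literature.AnabelianGeometry.SemiGraphs
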